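import Mathlib
import HarnessLib
import HarnessLib.Audit
import Summits.QuantumFields.Statement
import Literature.MathematicalPhysics.QuantumLattice.AdaptiveCoarseSystem
import Literature.MathematicalPhysics.QuantumFieldTheory.QuasiLocalGaugePerturbation
import Summits.QuantumFields.QCD.Theorems.NestedDissectionSeaThresholdShift

/-!
Route: AdaptiveBlockFermions

CLOSED (refuted) 2026-08-18T22:55:44Z by gate — reason: refuted:stmt-QuantumFields-9494 (AdaptiveCoarseSystem) by Summit.QuantumFields.QCD.Theorems.AdaptiveBlockFermionsAdaptiveCoarseSystem_refuted — note: repair grace of 72.0 h (deadline 2026-08-18T22:54:06Z) expired without a repair — closed by the gate. The file is kept as the record of this route; refuted decls are indexed as negative knowledge (`ledger negatives`).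

# Route AdaptiveBlockFermions — NEXT LINE (2026-08-15, after the substantive refutation of
AdaptiveCoarseSystem): the SOFT capture-frame block spin — Bałaban–O'Carroll–Schor's
exponential-weight fluctuation operator T = D_W + (a/b)·Σ|g⟩⟨g| with configuration-ADAPTED
collar-local frames (no chirality split, no Riesz basis, no smoothness, no Galerkin compression) is
well-posed and Combes–Thomas-local on EVERY SU(3) field; the QCD content is the tail of the local
near-zero-mode counts and the heavy-threshold bridge onto robust Yang–Mills

It suffices to show X = E″ ∧ P′ ∧ R ∧ B″ (card adaptive-coarse-space-block-fermions, second
approach; threshold end-game of heavy-threshold-robust-ym-bridge). ROUTE CHOICE (rchoice seat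
c38f86b2, 2026-08-16T11Z, after three route-repair generations; evidence ROUTE-CHOICE.md): KEEP —
gate re-evaluation / operator surgery requested, NOT retired, because nothing about this line is
refuted: the file builds (lean rc 0, re-checked 2026-08-16), the deciding theorem `closes hE hP hR
hB : QCD` is native-OK over the four live, unrefuted cruxes below (extra = [], audit-g7 re-basing
proved inline), ground ok, staffable. The route is BROKEN only in bookkeeping: the refuted
FIRST-line engine AdaptiveCoarseSystem (stmt-QuantumFields-9494) is still an active entry, and the
gate's named repair cannot be applied by any planner verb (re-verified after the 2026-08-16 gate
reload): the four-record drop bounces `route.multi-assembly: 3 assembly items … keep exactly one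
assembly`, including the surplus assembly entries bounces `the assembly item cannot be dropped`, and
assembly entries can be neither retriaged nor merged by restate. The three assembly-kind entries
(numbered by position at each render): stmt-QuantumFields-9500 `Assembly22` (the deciding chain —
the one to keep), stmt-QuantumFields-8699 `Assembly2` (the shared PROVED ThresholdShift, mis-badged
assembly at open; support on four other routes), stmt-QuantumFields-15123 `Assembly` (verbatim
duplicate of 8699 from a g3 `workitem add --name Assembly` probe). ONE OPERATOR ACTION before the
repair deadline 2026-08-18T22:54Z (else the hygiene loop closes the route `refuted`, mislabelling a
live line and its card): (α) detach or re-kind to support this route's entries on stmt-8699 and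
stmt-15123 — neither is used by `closes` — then `ledger route edit
route-QuantumFields-AdaptiveBlockFermions --drop AdaptiveCoarseSystem --drop ThresholdFlowClosure
--drop CollarModeTail --drop CompressedPropagatorLocality --note '…'` (11 items, 1 assembly, 4
ranked cruxes, closes unchanged; the Refutation theorem file, which imports this file and names the
dropped decl, then needs the MultibosonBridge-style local re-declaration); or (β) let the caps check
pass BROKEN-repair edits that increase no existing violation; or (γ) open the certified clean
re-filing (evidence route_reopen.json + glue4.lean, slug SoftCaptureFrames, 11 items) and close this
route superseded by it. FALLBACK for a planner seat finding it still BROKEN in the last 12 h of the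
grace: retry the drop once; if it still bounces, close deliberately `--as retired --reason 'gate
catch-22 (route.multi-assembly); next line unrefuted'` with a census note (never let it auto-close
refuted) and re-file the next line — every statement below is verbatim re-usable, `closes` is the
glue. Until then the first line's records (AdaptiveCoarseSystem — refuted, CollarModeTail —
misstated, ThresholdFlowClosure — vacuous, CompressedPropagatorLocality — unconsumed) stay in the
file, outside the deciding theorem.
E″ (ENGINE, `LocalCaptureFrames`, deterministic, every configuration, every mass): universal
constants c₀, C_w, K, Θ, N₀, N₁ such that for every torus L, block side b ≥ 2 with b ∣ L, every U
and m, the Wilson–Dirac operator D admits a finite tagged family of generators (home block B, vector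
g supported in the 3⁴-collar of B), at most N₀ + N₁·n_B per home block (n_B = `collarModeCount`:
eigenvalues of (D|collar)ᴴ(D|collar) below (c₀/b)²), with Bessel bound Θ and the CAPTURE inequality
‖x‖² ≤ C_w²b²‖Dx‖² + K Σ_g |⟨g,x⟩|² for all x (weak approximation property in frame form).
P′ (PROBABILISTIC INPUT, `QuenchedCollarModeTail`, pure-gauge, its OWN N_f = 0 ruler): along every
two-loop asymptotically scaling pure-gauge sequence (a_k, L_k, β_k; Λ) and for every c₀, the counts
n_B have exponential moments bounded uniformly in k, in the volume S ≥ L_k, the position and m ∈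
[−1,1], for blocks of physical size b·a_k ≤ ℓ.
R (`RobustYangMills`, SHARED with HeavyThresholdYMBridge / NestedDissectionSea,
stmt-QuantumFields-13897): robust SU(3) lattice Yang–Mills under admissible quasi-local
perturbations.
B″ (BRIDGE, `SoftThresholdClosure`, THRESHOLD form since the 2026-08-15 ground repair, as
HeavyThresholdYMBridge.ThresholdQCD / NestedDissectionSea): E″ → P′ → R → for N_f ∈ {2,3} a witness
offset M₀ ≥ 0 and ONE mass-independent regularisation with HasMassScaling giving every conclusion of
QCDOf N_f (OS data along the scheme, non-trivial non-Gaussian glue, dynamical quarks, one continuum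
+ lattice gap) for all mass tuples above M₀ — the soft adaptive steps, composed scale by scale (log
det D_W = Σ_j log det T_j + log det D′_last, each factor local), make W_k = −N_f log det D_W(U,
m(k)) an admissible quasi-local perturbation at the threshold scale ℓ₀ = c/M₀ with m_crit, Z_m
tuned, and R yields the threshold form; the audit-g7 re-basing (ThresholdShift: m_crit(k) ↦
m_crit(k) + a_k M₀/Z_m(k), proved inline; = Theorems.thresholdShift_generic) turns it into QCDOf 2 ∧
QCDOf 3 inside the deciding theorem `closes hE hP hR hB`.
Lean: `LocalCaptureFrames ∧ QuenchedCollarModeTail ∧ RobustYangMills ∧ SoftThresholdClosure`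

Rationale: WHY THIS LINE. The first line (hard Galerkin compression of D_W with chirality-split, D-smooth,
Riesz-stable adaptive coarse spaces) died three ways on 2026-08-15: (i)
`AdaptiveBlockFermionsAdaptiveCoarseSystem_refuted` (landed): chirality (b) + D-smoothness (e) +
coercivity (f) are jointly inconsistent for the NON-NORMAL Wilson–Dirac operator (a γ₅-invariant
D-smooth space is D†-smooth; low right-singular vectors are D†-low only at √ε); (ii)
Cruxes/AdaptiveCoarseSystem/Ideas/obstruction.md: the hard inf–sup (g) is ≤ (π²/8)C_s²/b² for every
block-periodic chirality-split design already at U = 1 (coarse doubler = Nielsen–Ninomiya index on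
the coarse Brillouin torus; BalabanOcarrollSchor1989 §IV (4.5) is the sharp corner case); (iii)
Ideas/landauobstruction.md: (a)+(d)+(e)+(f) fail on constant-flux fields (a Riesz-local basis is
Chern-trivial, the low Landau band is not). All three analyses point to the same survivor, which
this revision files: Bałaban–O'Carroll–Schor's SOFT (exponential-weight) block spin — fluctuation
operator T = D_W + (a/b)Σ_g|g⟩⟨g| (BalabanOcarrollSchor1989 Thm III.1, the only rigorous
block-fermion theorem), the SAME blocking for ψ and ψ̄, with the fixed averaging kernel replaced by
configuration-adapted collar-local FRAMES (redundant generators allowed; Kalkreuter–Mack–Speh's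
adaptive blockspin doi:10.1142/s0129183192000105 and Lüscher's local coherence Luscher2007 are the
numerical ancestors; GenEO SpillaneEtAl2013 the SPD template). Two elementary observations (planner,
this revision; both filed as provable-now supports) carry the per-configuration theory: SOFT GAP
FROM CAPTURE — accretivity Re D_W(U,m) = m + ½Σ|1−U_μT_μ|² ≥ m plus the capture inequality force
‖Tx‖ ≥ (c₁/b)‖x‖ (five lines: Re⟨x,Tx⟩ small ⇒ ⟨x,Sx⟩ small ⇒ ‖Dx‖ small ⇒ capture violated), and
CAPTURE FRAMES BY IMS — a χ_B² partition of unity on collars and the n_B lowest eigenvectors of each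
Dirichlet collar operator give ‖x‖² ≤ (b²/C₁)‖Dx‖² + 2Σ|⟨χ_B e_{B,i},x⟩|² with Bessel constant 81
(CyconEtAl1987 §3.1 IMS formula; SpillaneEtAl2013 Lemma 2.x stable splitting). Hence neither
chirality, nor orthogonality, nor smoothness, nor a compression is needed; the coarse doubler only
gives the coarse action the cutoff mass a/b at θ*** (harmless, as for BOS); frames evade the Chern
obstruction. What remains QCD-specific is exactly Lüscher's empirical fact as a property of the
MEASURE (P′: local near-zero-mode counts have exponential tails for blocks up to a physical size ℓ)
and the multiscale bridge (B″) onto robust Yang–Mills (R, shared). Imported areas: domain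
decomposition / numerical homogenisation (capture = weak approximation property,
FalgoutVassilevski2004), Schrödinger-operator localisation (IMS, Combes–Thomas CombesThomas1973,
AizenmanGraf1998), constructive RG (BOS, Balaban1989LargeFieldII). Negatives index: the refuted
AdaptiveCoarseSystem is dropped (settled negative edge), none of its killed clauses (b),(d),(e),(g)
reappears.
RANKED CRUXES. #2 LocalCaptureFrames — the capture-frame ENGINE (most informative: a Lean proof
certifies the engine for every field, a refutation kills the line at once; planner's IMS sketch says
provable, difficulty L). #3 QuenchedCollarModeTail — with its own N_f = 0 ruler (the QCD-specific
input; supersedes CollarModeTail, after the refuters' MISSTATED flag on CollarModeTail: quenched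
spacing vs scheme spacing, N_f ≥ 17; XL; decidable in physics terms by dislocation counting). #4
RobustYangMills (shared named condition stmt-QuantumFields-13897; staffed through
HeavyThresholdYMBridge). #5 SoftThresholdClosure (BRIDGE E″ → P′ → R → threshold form of QCDOf 2 ∧
QCDOf 3 — all renormalised masses above a witness offset M₀ ≥ 0, audit g7; re-typed 2026-08-15 by
the ground-repair planner from the direct `→ QCD` form, which it implies with M₀ = 0 and which it
gives back with ThresholdShift (Sketch2.lean rc0) — ranked after R so that the file renders R first;
open-problem grade: the multiscale composition, tuning of m_crit/Z_m, the heavy residual integration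
and the admissibility — incl. reflection positivity, automatic for the EXACT determinant W_k = −N_f
log det D_W — of the effective action at scale ℓ₀). ASSEMBLY-KIND ENTRIES (three; the gate numbers
them by position at each render): `Assembly22` = stmt-9500 := LocalCaptureFrames →
QuenchedCollarModeTail → RobustYangMills → SoftThresholdClosure → ThresholdShift (inlined) → QCD,
the deciding chain as a Prop (modus ponens over `closes` + thresholdShift_generic); `Assembly2` =
the shared ThresholdShift stmt-8699 (proved, `Assembly2_holds`; mis-badged assembly at open);
`Assembly` = stmt-15123, a verbatim duplicate of 8699 (g3 probe accident, 2026-08-16; provable by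
the same term). None of the three is a hypothesis of `closes` since rev 14 (four live items, shift
inline). FIRST-LINE RECORDS still in the file (not in the deciding theorem): AdaptiveCoarseSystem
(refuted), CollarModeTail (misstated, refuter-blocked), ThresholdFlowClosure (vacuous after the
refutation), CompressedPropagatorLocality (hard Combes–Thomas, unconsumed) — to be dropped once the
operator has removed or re-badged the surplus assembly-kind entries (8699, 15123): until then every
item-changing `route edit` bounces on D-0019 route.multi-assembly (re-verified 2026-08-16 by the g2
and g3 repair seats; exact bounce texts and the post-fix command in evidence REPAIR-STATUS-G3.md;
certified clean re-filing route_reopen.json + glue4.lean from g2 as the alternative); that drop is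
also what clears BROKEN. Supports: SoftGapFromCapture (S, new), WilsonAccretivity (M, new),
SoftPropagatorLocality (Combes–Thomas for T, L, new; supersedes the hard
CompressedPropagatorLocality), NotAdaptiveCoarseSystem (the refuted first engine negated, kept
compiled; provable now by the landed witness), FreeAveragingCoherence (BOS baseline, M),
CoarseActionGammaFive (candidate-proved).
TWO-LAYER PLAN. SoftThresholdClosure ⇐ SoftFlowToThreshold (log det D_W(U,m(k)) = Σ_j log det T_j +
remainder with every T_j local by E″ + supports, m_crit(k), Z_m(k) tuned inside the flow,
HasMassScaling; needs HeavyThresholdYMBridge's definition requests) → HeavyAdmissibility (at ℓ₀ =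
c/M₀ the exact W_k = −N_f log det is AdmAt-admissible with NormLE controlled by P′'s tails as
large-field events) → (R applied to W_k ⇒ the threshold form of QCDOf 2 ∧ QCDOf 3 via
CouplingMatching, shared with HeavyThresholdYMBridge; the ThresholdShift re-basing is outside the
crux, proved inline in `closes`) → SoftThresholdClosure. QuenchedCollarModeTail ⇐ SmallFieldCount
(deterministic: ε-smooth collars carry ≤ N₀ modes, KineticEdge-type bound) → DislocationRarity
(Wilson-measure large-field/dislocation bounds at β_k, uniform in volume) → QuenchedCollarModeTail.
No split of LocalCaptureFrames foreseen (direct proof).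
KILL CRITERIA. (1) ¬LocalCaptureFrames (any configuration family defeating collar-local capture
frames with cardinality N₀ + N₁ n_B) closes the route `refuted:LocalCaptureFrames` — no third
statement of the engine. (2) A dislocation/Aoki-phase estimate showing E e^{t n_B} unbounded for b
a_k ≤ ℓ at arbitrarily small ℓ under the quenched measure refutes P′: pivot only if the failure is
confined to m below the quenched critical line (restate the m-range to the physical branch), else
close. (3) A proof that the exact heavy determinant cannot meet AdmAt's NormLE at any ℓ₀
(HeavyThresholdYMBridge's HeavyBlockIntegration refuted), or ¬RobustYangMills, kills B″ here too.
Proved elsewhere: FermionicUVFlow + HeavyBlockIntegration by another engine moots E″/P′ but not the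
card.
NOT DECOMPOSED YET. Constants of E″ (c₀² = 4C_IMS, Θ = 81, K = 2); the unquenched (det-weighted)
version of P′ and the coupling matching between the N_f scheme and the N_f = 0 ruler (inside B″);
every piece of the bridge (analytic dependence of frames on U — smooth spectral filters χ(D_BᴴD_B)
with randomised/pivoted subsampling instead of eigenvectors —, scale-wise tuning, large-field
bookkeeping driven by n_B, the residual heavy expansion in BLOCK units inside the
HoppingExpansionUniformGap disc, OS axioms from RP of the FINE Wilson theory). Light quarks below
the threshold are not claimed (threshold reading of QCDOf, audit g7).
CHEAPEST FALSIFIER. For E″: prove or refute it in Lean on the refuter's L = 1 witness family and on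
U = 1 (both pass on paper: L = 1 ⇒ collar = torus, gens = global low right-singular vectors; det(A +
a′P_{f₀}) = 8ε + 6a′ > 0 for the soft operator). For P′: quenched SU(3) ensembles at two spacings
with b·a fixed — histogram of Dirichlet-collar counts n_B below (c₀/b)² at m ∈ {m_c(β), −0.5, −1};
published local-coherence data (Luscher2007 Tables 1–2, FrommerEtAl2013 §5) give O(10) per 4⁴ block
for the mean; the tail and the a-dependence are the open numbers (kit job not filed from this
compute-free seat). For the supports: SoftGapFromCapture is a 5-line norm argument (refuter can
Lean-check it in an hour).
NUMBERS. IMS: C₁ = Σ_B‖[D,χ_B]‖² ≤ 81·(8·c/b)² per site ⇒ c₀ ≈ 2√C₁·b… i.e. c₀ = O(10²) universal;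
Bessel Θ = 3⁴ = 81 (collar overlap); capture K = 2, C_w² = 1/C₁. Soft gap: with a = 1, c₁ small s.t.
C_w²(c₁ + √(aΘ(c₁ + c_res/b)))² + K(c₁ + c_res/b)/a < 1. Free field: n_B = O(c₀⁴) modes per collar
uniformly in b; Banks–Casher at physical block size ℓ: mean count ≈ 81 Σ c₀ ℓ³ ⇒ ℓ ≲ (Σc₀)^{-1/3}.
Quenched m_c(β_W = 6.0) ≈ −0.8; dislocation density per site ∼ e^{−β S_d} must be O(a⁴)
(PughTeper1989). Items after this revision: 17 entries — the 8 first-line entries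
(AdaptiveCoarseSystem refuted, CollarModeTail, ThresholdFlowClosure, CompressedPropagatorLocality,
CoarseActionGammaFive, FreeAveragingCoherence, the chain stmt-9500, the mis-badged 8699), the
duplicate 15123, and the next line's LocalCaptureFrames, QuenchedCollarModeTail, RobustYangMills
(shared), SoftThresholdClosure, WilsonAccretivity, SoftGapFromCapture, SoftPropagatorLocality,
NotAdaptiveCoarseSystem; 11 remain once the four dead first-line records and the two surplus
assembly-kind entries are removed.
DEFINITION REQUESTS. None new (E″ and P′ are typed over the landed `blockCollar` / `collarModeCount`
of Literature/MathematicalPhysics/QuantumLattice/AdaptiveCoarseSystem.lean; `IsAdaptiveCoarseSystem`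
itself is no longer used). The bridge's layer-2 children will need HeavyThresholdYMBridge's pending
`WilsonFermionBlockAveraging`-type vocabulary; a `IsCaptureFrame` bundle (clauses of E″) may be
requested by a grounder — not blocking.

Novelty: Searches (2026-08-15, this revision; local searchd/galaxy pdf timed out repeatedly (rc 75 / queue >
90 s), OpenAlex 429, arXiv 0 rows — logged in NOTES.md): `lit search --source crossref "Balaban
O'Carroll Schor block renormalization group fermions averaging operation"` (10:
doi:10.1007/bf01257414 BOS 1989 CMP, doi:10.1007/bf00401587 LMP 1989, doi:10.1063/1.529479 JMP 1991
external gauge field, doi:10.1007/bf01058429 O'Carroll 1993 "Lattice and continuum wavelets and the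
block renormalization group", doi:10.1006/aphy.1996.5651 Pereira–Procacci 1997 block RG with lattice
wavelets for interacting fermions — FIXED wavelet bases, free/perturbative); `lit search --source
crossref "Kalkreuter Mack Speh blockspin multigrid staggered fermions …"` (10:
doi:10.1142/s0129183192000105 KMS 1992 adaptive covariant blockspin = ground-state projection,
doi:10.1103/physrevd.51.1305 Kalkreuter 1995 why it failed, doi:10.1007/3-540-55997-3_34 Mack et al.
effective actions via multigrid — numerical); `lit search --source crossref "GenEO coarse space
heterogeneous Helmholtz indefinite absorption …"` (10: doi:10.1093/imanum/drac036 = BootlandEtAl2022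
indefinite/non-self-adjoint GenEO, doi:10.1007/s11075-025-02166-x Spillane 2025 survey,
SORAS-GenEO-2 — SPD/absorptive templates, GMRES bounds, no frame/soft-shift theorem for Dirac-type
operators); `lit read 10.1007/bf01257414 --grep "Theorem III|exponential|δ-function"` (held, 16 pp;
Thm III.1 p. 7: uniform-in-k exponential decay for the EXPONENTIAL  [refs: 10.1007/bf01257414, 10.1007/bf00401587, 10.1063/1.529479, 10.1007/bf01058429, 10.1006/aphy.1996.5651, 10.1142/s0129183192000105, 10.1103/physrevd.51.1305, 10.1007/3-540-55997-3_34, 10.1093/imanum/drac036, 10.1007/s11075-025-02166-x, doi:10.1007/bf01257414, doi:10.1007/bf00401587, doi:10.1063/1.529479, doi:10.1007/bf01058429, doi:10.1006/aphy.1996.5651, doi:10.1142/s0129183192000105, doi:10.1103/ph]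

Barriers (technique_class: block-spin-rg, spectral-coarse-space, combes-thomas): - technique_class: block-spin-rg, spectral-coarse-space, combes-thomas, soft-rgt
- Literature.Barriers.QuantumFields.HoppingExpansionUniformGap /
Literature.Barriers.QuantumFields.HoppingExpansionLocality: evaded — locality of T⁻¹ = (D_W +
(a/b)Σ|g⟩⟨g|)⁻¹ comes from the soft gap c₁/b (accretivity + capture, SoftGapFromCapture) via
Combes–Thomas in BLOCK units (SoftPropagatorLocality), never from |κ|h < 1 on the fine lattice; a
hopping/polymer expansion is used only at the threshold scale ℓ₀ in block units, inside the disc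
legitimately (as in HeavyThresholdYMBridge).
- Literature.Barriers.QuantumFields.NielsenNinomiya: not engaged by the new line — no chiral
symmetry and no chirality split is asked of the coarse space or the coarse action; the coarse
doubler of Cruxes/AdaptiveCoarseSystem/Ideas/obstruction.md (Poincaré–Hopf on the COARSE torus,
which killed the hard inf–sup (g)) only gives the soft coarse action D′ = τ − τ²GᴴT⁻¹G the cutoff
mass τ = a/b at θ***, which is harmless because nothing is divided by the coarse propagator.
- Literature.Barriers.QuantumFields.NoUltralocalGinspargWilson: not engaged — the generators are
ultralocal (collar-supported) but no Ginsparg–Wilson/chiral relation is demanded.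
- Literature.Barriers.QuantumFields.BanksCasherCriterion /
Literature.Barriers.QuantumFields.VafaWittenEigenvalueBound: respected — near-zero modes of D_W are
neither excluded nor bounded away; they are CAPTURED (given the coarse mass a/b) and COUNTED: n_B
enters the local

Novelty grade: new-combination — route-review grade (refuter-rreview-0815T13-28-0): NEW-COMBINATION. Legs: (1) rigorous block-fermion RG with FIXED averaging on free/smooth fields — BOS 1989 (doi:10.1007/bf01257414 Thm III.1, §IV, §V; planner READ), BOS 1991, Dimock (small fields); (2) configuration-ADAPTIVE gauge-covariant block-l (refuter refuter-rreview-0815T13-28-0, 2026-08-15T16:54:27Z; prior: doi:10.1007/bf01257414 (BalabanOcarrollSchor1989, Thm III.1/§IV/§V; planner READ), BalabanOcarrollSchor1991 (doi:10.1063/1.529479), Kalkreuter DESY-92-108 (1992) p.4 'gauge covariant ground-state projection MG … averaging kernels C' (READ this session, galaxy pdf:5017404640), arXiv:0706.2298 (Luscher2007 local coherence), arXiv:1303.1377 (FrommerEtAl2013 DD-αAMG), arXiv:1110.0692 (MalqvistPetersei)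

History (route lifecycle, newest last):
- 2026-08-15T22:54:06Z · BROKEN — AdaptiveCoarseSystem (stmt-QuantumFields-9494, crux) refuted by Summit.QuantumFields.QCD.Theorems.AdaptiveBlockFermionsAdaptiveCoarseSystem_refuted @ c9158cc36499 (refuter-cdisprove-stmt-QuantumFields-9494-0)
- 2026-08-16T14:43:05Z · LINT AUTOFIX route.multi-assembly: kept Assembly, dropped Assembly22, Assembly2 (gate:hygiene)
- 2026-08-18T22:55:44Z · CLOSED refuted — refuted:stmt-QuantumFields-9494 (AdaptiveCoarseSystem) by Summit.QuantumFields.QCD.Theorems.AdaptiveBlockFermionsAdaptiveCoarseSystem_refuted (grace expired, auto-close) (gate)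

sub-problem: QCD · status: closed(refuted) · opened planner-plancard-QuantumFields-QCD-adaptive-c-64f4d5b1-0 2026-08-15T13:58:35Z · rev 16 · ledger route-QuantumFields-AdaptiveBlockFermions
GENERATED by the gate from the ledger (D-0016/17). Provers cite these decls: `theorem foo : Summit.QuantumFields.QCD.Theses.AdaptiveBlockFermions.<Decl> := …` in Summits/QuantumFields/QCD/Theorems/<Name>.lean.
-/

namespace Summit.QuantumFields.QCD.Theses.AdaptiveBlockFermions

open scoped BigOperators Topology Manifold Classical MeasureTheory ProbabilityTheory Matrix InnerProductSpace ComplexConjugate ContinuousMap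
open Filter Set Function TopologicalSpace MeasureTheory

attribute [summit_statement] _root_.QCD

open Literature.MathematicalPhysics.QuantumFieldTheory

/-- item stmt-QuantumFields-13982 · crux · rank 2 · closed · moot by None · by planner
why it might fail: Planner's IMS sketch (χ_B² partition of unity × lowest Dirichlet-collar eigenvectors; c₀²=4C_IMS, Θ=81, K=2) is paper-only: the commutator bound at b=2,3 and the tag/collar aliasing for L/b ≤ 2 must survive Lean; any field beating collar-local capture at cardinality N₀+N₁n_B kills the line.
sources: SpillaneEtAl2013, CyconEtAl1987, FalgoutVassilevski2004, Luscher2007, BalabanOcarrollSchor1989, doi:10.1142/s0129183192000105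
[crux] ENGINE of the route's NEXT LINE (soft capture-frame block spin; route choice 2026-08-15 after
the substantive refutation of AdaptiveCoarseSystem). Universal c₀, C_w, K, Θ > 0 and N₀, N₁ such
that for every torus side L, block side b ≥ 2 with b ∣ L, every U : GaugeConfig 4 L SU(3) and EVERY
mass m, D = wilsonDirac (fundamentalRep (Fin 3)) U m 1 admits a finite TAGGED generator family gens
⊂ (home block B : Fin 4 → ℕ) × (vector g) with: (a) tags in range (B i < L/b) and g supported in the
3⁴-block collar of its home block (`blockCollar`, blocks = ⌊coordinate/b⌋ in ZMod (L/b)); (c) at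
most N₀ + N₁·n_B generators carry the home tag B, n_B = `collarModeCount D blk (L/b) B ((c₀/b)²)`
(eigenvalues of (D|collar B)ᴴ(D|collar B) below (c₀/b)²); (d⁺) Bessel bound ‖Σ α_e g_e‖² ≤ Θ Σ|α_e|²
(upper frame bound only: redundant generators allowed, NO Riesz lower bound); (f′) CAPTURE ‖x‖² ≤
C_w² b² ‖Dx‖² + K Σ_e |⟨g_e, x⟩|² for every x (weak approximation property in frame form; for x ⊥
gens it is the old clause (f)). NO chirality, NO D-smoothness, NO compression/inf–sup — the three
refuted-edge mechanisms (two-sided smoothness forced by chirality, Chern obstruction to local Riesz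
bases, coar -/
@[route_item "route-QuantumFields-AdaptiveBlockFermions"]
def LocalCaptureFrames : Prop :=
  ∃ c₀ Cw K Θ : ℝ, 0 < c₀ ∧ 0 < Cw ∧ 0 < K ∧ 0 < Θ ∧ ∃ N₀ N₁ : ℕ, ∀ (L b : ℕ) [NeZero L], 2 ≤ b → b ∣ L → ∀ (U : Literature.MathematicalPhysics.QuantumFieldTheory.GaugeConfig 4 L (Matrix.specialUnitaryGroup (Fin 3) ℂ)) (m : ℝ), let D := Literature.MathematicalPhysics.QuantumLattice.wilsonDirac (Literature.MathematicalPhysics.QuantumLattice.fundamentalRep (Fin 3)) U m 1; let blk : (Literature.Probability.LatticeModels.TorusSite 4 L × Fin 3 × Fin 4) → Fin 4 → ℕ := fun p i => (p.1 i).val / b; ∃ gens : Finset ((Fin 4 → ℕ) × ((Literature.Probability.LatticeModels.TorusSite 4 L × Fin 3 × Fin 4) → ℂ)), (∀ e ∈ gens, (∀ i, e.1 i < L / b) ∧ ∀ p, e.2 p ≠ 0 → Literature.MathematicalPhysics.QuantumLattice.blockCollar blk (L / b) e.1 p) ∧ (∀ B : Fin 4 → ℕ, (gens.filter (fun e =>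 e.1 = B)).card ≤ N₀ + N₁ * Literature.MathematicalPhysics.QuantumLattice.collarModeCount D blk (L / b) B ((c₀ / (b : ℝ)) ^ 2)) ∧ (∀ α : ((Fin 4 → ℕ) × ((Literature.Probability.LatticeModels.TorusSite 4 L × Fin 3 × Fin 4) → ℂ)) → ℂ, (star (∑ e ∈ gens, α e • e.2) ⬝ᵥ (∑ e ∈ gens, α e • e.2)).re ≤ Θ * ∑ e ∈ gens, ‖α e‖ ^ 2) ∧ (∀ x : (Literature.Probability.LatticeModels.TorusSite 4 L × Fin 3 × Fin 4) → ℂ, (star x ⬝ᵥ x).re ≤ Cw ^ 2 * (b : ℝ) ^ 2 * (star (D *ᵥ x) ⬝ᵥ (D *ᵥ x)).re + K * ∑ e ∈ gens, ‖star e.2 ⬝ᵥ x‖ ^ 2)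

/-- item stmt-QuantumFields-9494 · crux · rank 2 · closed · refuted by Summit.QuantumFields.QCD.Theorems.AdaptiveBlockFermionsAdaptiveCoarseSystem_refuted @ c9158cc36499 (refuter) · by planner
why it might fail: Non-normal, indefinite D_W: chiral gens (b) make W γ₅-invariant, so (e) forces D- AND D†-smoothness; inf–sup (g) at rate c₁/b uniformly in rough U is known only by free-field Fourier analysis (BOS) — P_W·D leaks O(1/b), the capture threshold's order; overlapping collar modes may break Riesz (d).
sources: BalabanOcarrollSchor1989, BalabanOcarrollSchor1991, Luscher2007, FrommerEtAl2013, SpillaneEtAl2013, BootlandEtAl2022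
[crux] ENGINE (card K1 ∧ deterministic half of K2). Universal constants c₀, c_res, c₁, C_s, C_w, θ,
Θ > 0 and N₀, N₁ exist such that for every torus side L, block side b ≥ 2, every U : GaugeConfig 4 L
SU(3) and every mass with −c_res/b² ≤ m ≤ 1 there is a finite generator family gens for D =
wilsonDirac (fundamentalRep (Fin 3)) U m 1 with: (a) each generator supported in a collar (the 3⁴
blocks around a block, blocks = floor(coordinate/b), wrap-around by ZMod (L/b)); (b) each generator
of definite chirality (spin index < 2 or ≥ 2; γ₅ = diag(1,1,−1,−1) in the tree's basis); (c) local
dimension: generators supported in collar(B) number ≤ N₀ + N₁·n_B, n_B = #{eigenvalues of (D|collar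
B)ᴴ(D|collar B) below (c₀/b)²}; (d) Riesz stability θ Σ|α_g|² ≤ ‖Σ α_g g‖² ≤ Θ Σ|α_g|²; (e)
D-smoothness b²‖Dw‖² ≤ C_s²‖w‖² on W = span gens; (f) complementary coercivity: every f ⊥ gens has
‖f‖ ≤ C_w b ‖Df‖ (the orthogonal-complement form of the weak approximation property — the ∀v∃w form
is NOT asked: an exact zero mode with non-compact support could only be contained in W at unbounded
local dimension, while (f) tolerates exponentially small truncation); (g) inf–sup: for every u ⊥
gens there is v ⊥ gens -/
@[route_item "route-QuantumFields-AdaptiveBlockFermions"]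
def AdaptiveCoarseSystem : Prop :=
  ∃ c₀ cres c₁ Cs Cw θ Θ : ℝ, 0 < c₀ ∧ 0 < cres ∧ 0 < c₁ ∧ 0 < Cs ∧ 0 < Cw ∧ 0 < θ ∧ 0 < Θ ∧ ∃ N₀ N₁ : ℕ, ∀ (L b : ℕ) [NeZero L], 2 ≤ b → ∀ (U : Literature.MathematicalPhysics.QuantumFieldTheory.GaugeConfig 4 L (Matrix.specialUnitaryGroup (Fin 3) ℂ)) (m : ℝ), -(cres / (b : ℝ) ^ 2) ≤ m → m ≤ 1 → let D := Literature.MathematicalPhysics.QuantumLattice.wilsonDirac (Literature.MathematicalPhysics.QuantumLattice.fundamentalRep (Fin 3)) U m 1; let blk : (Literature.Probability.LatticeModels.TorusSite 4 L × Fin 3 × Fin 4) → Fin 4 → ℕ := fun p i => (p.1 i).val / b; let collar : (Fin 4 → ℕ) → (Literature.Probability.LatticeModels.TorusSite 4 L × Fin 3 × Fin 4) → Prop := fun B p => ∀ i, ((blk p i : ℕ) : ZMod (L / b)) - ((B i : ℕ) : ZMod (L / b)) = 0 ∨ ((blk p i : ℕ) : ZMod (L / b)) - ((B i : ℕ) :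 ZMod (L / b)) = 1 ∨ ((blk p i : ℕ) : ZMod (L / b)) - ((B i : ℕ) : ZMod (L / b)) = -1; let n : (Fin 4 → ℕ) → ℕ := fun B => Fintype.card {i // (Matrix.isHermitian_conjTranspose_mul_self (D.toBlock (collar B) (collar B))).eigenvalues i < (c₀ / b) ^ 2}; ∃ gens : Finset ((Literature.Probability.LatticeModels.TorusSite 4 L × Fin 3 × Fin 4) → ℂ), (∀ g ∈ gens, ∃ B : Fin 4 → ℕ, ∀ p, g p ≠ 0 → collar B p) ∧ (∀ g ∈ gens, (∀ p, g p ≠ 0 → (p.2.2 : ℕ) < 2) ∨ (∀ p, g p ≠ 0 → 2 ≤ (p.2.2 : ℕ))) ∧ (∀ B : Fin 4 → ℕ, (gens.filter (fun g => ∀ p, g p ≠ 0 → collar B p)).card ≤ N₀ + N₁ * n B) ∧ (∀ α : ((Literature.Probability.LatticeModels.TorusSite 4 L × Fin 3 × Fin 4) → ℂ) → ℂ, θ * (∑ g ∈ gens, ‖α g‖ ^ 2) ≤ (star (∑ g ∈ gens, α g • g) ⬝ᵥ (∑ g ∈ gens, α g • g)).re ∧ (star (∑ g ∈ gens, α g •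 g) ⬝ᵥ (∑ g ∈ gens, α g • g)).re ≤ Θ * ∑ g ∈ gens, ‖α g‖ ^ 2) ∧ (∀ w ∈ Submodule.span ℂ (↑gens : Set ((Literature.Probability.LatticeModels.TorusSite 4 L × Fin 3 × Fin 4) → ℂ)), (b : ℝ) ^ 2 * (star (D *ᵥ w) ⬝ᵥ (D *ᵥ w)).re ≤ Cs ^ 2 * (star w ⬝ᵥ w).re) ∧ (∀ f, (∀ g ∈ gens, star g ⬝ᵥ f = 0) → (star f ⬝ᵥ f).re ≤ Cw ^ 2 * (b : ℝ) ^ 2 * (star (D *ᵥ f) ⬝ᵥ (D *ᵥ f)).re) ∧ (∀ u, (∀ g ∈ gens, star g ⬝ᵥ u = 0) → ∃ v, (∀ g ∈ gens, star g ⬝ᵥ v = 0) ∧ (star v ⬝ᵥ v).re ≤ 1 ∧ c₁ * Real.sqrt ((star u ⬝ᵥ u).re) ≤ (b : ℝ) * (star v ⬝ᵥ (D *ᵥ u)).re)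

/-- item stmt-QuantumFields-13983 · crux · rank 3 · closed · moot by None · by planner
why it might fail: Dislocations/Aoki: for m ∈ [−1,0) at weak coupling the quenched measure carries near-real modes of per-site density e^{−βS_d}; exponential moments over 81b⁴-site collars, b ≤ ℓ/a_k, need density O(a_k⁴) (SU(3) dislocation problem) and sub-Poisson tails; Dirichlet cuts may add surface modes.
sources: Luscher2007, PughTeper1989, EdwardsHellerNarayanan1998, GoltermanShamir2003, Luscher1982Topology, Balaban1989LargeFieldII
[crux] PROBABILISTIC INPUT of the next line, with its OWN pure-gauge ruler (supersedes
CollarModeTail, refuter-flagged MISSTATED: quenched measure at the N_f-scheme coupling made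
quenched-physical block sizes unbounded; N_f unrestricted). For every pure-gauge scaling datum —
spacings a_k > 0, a_k → 0, half-sides L_k with a_k L_k → ∞, inverse couplings β_k with β_k − afBeta
0 Λ a_k → 0 for some Λ > 0 (two-loop N_f = 0 asymptotic scaling in the tree's normalisation β =
2/g₀²) — and every threshold c₀ > 0 there are ℓ, t > 0 and K such that eventually in k, on every
torus of side 2S+1 with S ≥ L_k, for every block side b ≥ 2 with b·a_k ≤ ℓ, every m ∈ [−1,1] and
every block B: ∫ exp(t·n_B(U)) dμ_Wilson(β_k) ≤ K, n_B = `collarModeCount` of wilsonDirac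
(fundamentalRep (Fin 3)) U m 1 on the 3⁴-collar of B at threshold (c₀/b)². 'Local coherence off
dilute defects' as a checkable large-deviation property of the SU(3) Wilson measure. why it might
fail: dislocations/Aoki — for m ∈ [−1,0) at weak coupling the quenched measure carries near-real
modes of per-site density e^{−βS_d}; exponential moments over 81b⁴-site collars with b ≤ ℓ/a_k need
that density O(a_k⁴) (SU(3) dislocation problem, Pugh -/
@[route_item "route-QuantumFields-AdaptiveBlockFermions"]
def QuenchedCollarModeTail : Prop :=
  ∀ (a : ℕ → ℝ) (Lk : ℕ → ℕ) (β : ℕ → ℝ) (Λ : ℝ), (∀ k, 0 < a k) → Filter.Tendsto a Filter.atTop (nhds 0) → Filter.Tendsto (fun k => a k * Lk k) Filter.atTop Filter.atTop → 0 < Λ → Filter.Tendsto (fun k => β k - Literature.MathematicalPhysics.QuantumFieldTheory.afBeta 0 Λ (a k)) Filter.atTop (nhds 0) → ∀ c₀ : ℝ, 0 < c₀ → ∃ ℓ : ℝ, 0 < ℓ ∧ ∃ t : ℝ, 0 < t ∧ ∃ K : ℝ, ∀ᶠ k in Filter.atTop, ∀ (S b : ℕ), Lk k ≤ S → 2 ≤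 b → (b : ℝ) * a k ≤ ℓ → ∀ m ∈ Set.Icc (-1 : ℝ) 1, ∀ B : Fin 4 → ℕ, ∫ U, Real.exp (t * (Literature.MathematicalPhysics.QuantumLattice.collarModeCount (Literature.MathematicalPhysics.QuantumLattice.wilsonDirac (Literature.MathematicalPhysics.QuantumLattice.fundamentalRep (Fin 3)) U m 1) (fun p : Literature.Probability.LatticeModels.TorusSite 4 (2 * S + 1) × Fin 3 × Fin 4 => fun i => (p.1 i).val / b) ((2 * S + 1) / b) B ((c₀ / (b : ℝ)) ^ 2) : ℝ)) ∂(Literature.MathematicalPhysics.QuantumFieldTheory.wilsonMeasure (d := 4) (L := 2 * S + 1) (Literature.MathematicalPhysics.QuantumLattice.fundamentalRep (Fin 3)) (β k)) ≤ K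

/-- item stmt-QuantumFields-9495 · crux · rank 3 · closed · moot by None · by planner
why it might fail: Quenched measure but cap b·a_k ≤ ℓ in the N_f-scheme spacing: for N_f ≥ 1, b₀(N_f) < b₀(0) makes a_q(β_k)/a_k → ∞, so at m = m_c(β_k) ∈ [-1,0) Banks–Casher gives n_B ~ Σ_q·c₀·(b·a_q)³ → ∞: E e^{t n_B} unbounded (likely false as typed); at N_f = 0: dislocations, ρ_H(0) > 0 supercritical (EHN).
sources: Luscher2007, GoltermanShamir2003, EdwardsHellerNarayanan1998, HernandezJansenLuscher1999, Balaban1989LargeFieldII, doi:10.1088/1126-6708/2006/02/011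
[crux] PROBABILISTIC INPUT (card K1, probabilistic half; QCD-specific). For every N_f and every
scheme sch : QCDScheme N_f with two-loop asymptotic scaling, and every threshold constant c₀ > 0,
there are ℓ, t > 0 and K such that eventually in k, on every torus of side 2S+1 ≥ 2L_k+1, for every
block side b ≥ 2 with b·a_k ≤ ℓ (blocks at most of physical size ℓ), every m ∈ [−1, 1] and every
block position B, the local count n_B(U) (eigenvalues of the collar-restricted D_W(U,m)†D_W(U,m)
below (c₀/b)²) has ∫ exp(t·n_B(U)) dμ_Wilson(β_k) ≤ K under the quenched SU(3) Wilson measure at the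
scheme's own coupling. This is "local coherence off dilute defects" as a checkable property of the
measure: bounded local coarse dimension except on exponentially rare patches, uniformly in spacing,
volume and position. [difficulty: XL] -/
@[route_item "route-QuantumFields-AdaptiveBlockFermions"]
def CollarModeTail : Prop :=
  ∀ (Nf : ℕ) (sch : Literature.MathematicalPhysics.QuantumFieldTheory.QCDScheme Nf), sch.HasAsymptoticScaling → ∀ c₀ : ℝ, 0 < c₀ → ∃ ℓ : ℝ, 0 < ℓ ∧ ∃ t : ℝ, 0 < t ∧ ∃ K : ℝ, ∀ᶠ k in Filter.atTop, ∀ (S b : ℕ), sch.L k ≤ S → 2 ≤ b → (b : ℝ) * sch.a k ≤ ℓ → ∀ m ∈ Set.Icc (-1 : ℝ) 1, ∀ B : Fin 4 → ℕ, let collar : (Literature.Probability.LatticeModels.TorusSite 4 (2 * S + 1) × Fin 3 × Fin 4) → Prop := fun p => ∀ i, ((((p.1 i).val / b : ℕ) : ZMod ((2 * S + 1) / b)) - ((B i : ℕ) : ZMod ((2 * S + 1) / b)) = 0 ∨ (((p.1 i).val / b : ℕ) : ZMod ((2 * S + 1) / b)) - ((B i : ℕ) : ZMod ((2 * S + 1)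 / b)) = 1 ∨ (((p.1 i).val / b : ℕ) : ZMod ((2 * S + 1) / b)) - ((B i : ℕ) : ZMod ((2 * S + 1) / b)) = -1); let n : Literature.MathematicalPhysics.QuantumFieldTheory.GaugeConfig 4 (2 * S + 1) (Matrix.specialUnitaryGroup (Fin 3) ℂ) → ℕ := fun U => Fintype.card {i // (Matrix.isHermitian_conjTranspose_mul_self ((Literature.MathematicalPhysics.QuantumLattice.wilsonDirac (Literature.MathematicalPhysics.QuantumLattice.fundamentalRep (Fin 3)) U m 1).toBlock collar collar)).eigenvalues i < (c₀ / b) ^ 2}; ∫ U, Real.exp (t * (n U : ℝ)) ∂(Literature.MathematicalPhysics.QuantumFieldTheory.wilsonMeasure (d := 4) (L := 2 * S + 1) (Literature.MathematicalPhysics.QuantumLattice.fundamentalRep (Fin 3)) (sch.β k)) ≤ K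

/-- item stmt-QuantumFields-13897 · crux · rank 4 · open · by planner
why it might fail: Open ⊇ SU(3) YangMills: β- and action-universality of the gapped phase (incl. E1) for EVERY a.f. sequence and every RP, sup-small, range-controlled W; a Wilson-rigid gap proof gives nothing; universal η₀ may be too big at ℓ₀Λ′≈1 (shared item).
sources: JaffeWitten2000, JaffeWittenClay2006, Balaban1988Convergent, Balaban1989LargeFieldII, DobrushinShlosman1985, OsterwalderSeilerAnnPhys1978
[crux] RobustYangMills — rev 4, REPAIRED 2026-08-15 (2nd refuter crux-attack, class misstated,
witness W-pair: D1's weighted norm charges e^{κ|X|} by the NUMBER of blocks and D1 polymers need not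
be connected, so range-S two-plaquette couplings −εJ·Q_p·Q_{p′} on ≤ 6 blocks were admissible and
gave connected plaquette correlations ≍ 1/S at time separation S, against the uniform-in-S lattice
gap (iii′); repaired as the refuter's C′ = rev-3 body + (h4)). OPENNESS OF THE GAPPED SU(3)
YANG–MILLS PHASE in the coupling-relative, sup-small, RANGE-CONTROLLED quasi-local,
reflection-positive, lattice-symmetric action cone: there are η₀ > 0 and κ ≥ 0 (universal for SU(3),
Wilson/fundamental) such that for all scaling data (a_k → 0, a_k L_k → ∞), EVERY N_f = 0 two-loop
a.f. coupling sequence β′ (Λ′ > 0, β′_k − afBeta 0 Λ′ a_k → 0), every block scale ℓ₀ > 0 (b_k =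
⌊ℓ₀/a_k⌋) and every family W = (W_{k,S}) in D1 `QuasiLocalGaugePerturbation 4 (2S+1) SU(3) b_k`
which, eventually in k and for all S ≥ L_k, (h1) has total invariant under ALL lattice translations,
the time reflection and the axis permutations, (h2) gives a reflection-positive perturbed measure at
β′_k (D1 `IsReflectionPositive`), (h3) -/
@[route_item "route-QuantumFields-AdaptiveBlockFermions"]
def RobustYangMills : Prop :=
  open Literature.MathematicalPhysics.QuantumLattice Literature.MathematicalPhysics.AQFT Literature.MathematicalPhysics.QuantumFieldTheory in let G := ↥(Matrix.specialUnitaryGroup (Fin 3) ℂ); let ρ : G →* Matrix (Fin 3) (Fin 3) ℂ := fundamentalRep (Fin 3); let r₃ : LatticeRep G := ⟨3, ρ, continuous_fundamentalRep _, fundamentalRep_injective _, fundamentalRep_mem_unitaryGroup⟩; ∃ η₀ : ℝ, 0 < η₀ ∧ ∃ κ : ℝ, 0 ≤ κ ∧ ∀ (a : ℕ → ℝ) (L : ℕ → ℕ) (ha : ∀ k, 0 < a k) (ha₀ : Filter.Tendsto a Filter.atTop (nhds 0)) (haL : Filter.Tendsto (fun k => a k * L k) Filter.atTop Filter.atTop)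 (β' : ℕ → ℝ) (Λ' : ℝ), 0 < Λ' → Filter.Tendsto (fun k => β' k - afBeta 0 Λ' (a k)) Filter.atTop (nhds 0) → ∀ ℓ₀ : ℝ, 0 < ℓ₀ → let η : ℝ := η₀ / max 1 (afBeta 0 Λ' ℓ₀); let AdmAt : ((k : ℕ) → (S : ℕ) → QuasiLocalGaugePerturbation 4 (2 * S + 1) G ⌊ℓ₀ / a k⌋₊) → ℕ → Prop := fun W k => ∀ S : ℕ, L k ≤ S → (∀ (v : Site 4 (2 * S + 1)) (U : GaugeConfig 4 (2 * S + 1) G), (W k S).total (torusConfigShift v U) = (W k S).total U) ∧ (∀ U : GaugeConfig 4 (2 * S + 1) G, (W k S).total (GaugeConfig.timeReflect U) = (W k S).total U) ∧ (∀ (π : Equiv.Perm (Fin 4)) (U : GaugeConfig 4 (2 * S + 1) G), (W k S).total (fun e => U (e.1 ∘ π, π.symm e.2)) = (W k S).total U) ∧ (W k S).IsReflectionPositive ρ (β' k) ∧ (W k S).NormLE κ η ∧ (∀ X : Finset (Site 4 (2 * S + 1)), X ∈ polymers ⌊ℓ₀ / a k⌋₊ → (∃ U : GaugeConfig 4 (2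 * S + 1) G, (W k S).act X U ≠ 0) → ∀ y ∈ X, ∀ y' ∈ X, ∀ i : Fin 4, (y i - y' i).val ≤ ⌊ℓ₀ / a k⌋₊ * X.card ∨ (y' i - y i).val ≤ ⌊ℓ₀ / a k⌋₊ * X.card); ∀ W, (∀ᶠ k in Filter.atTop, AdmAt W k) → ∃ φ : ℕ → ℕ, StrictMono φ ∧ ∃ (c m : YMSpecies G → ℕ → ℝ) (T : OSData (YMSpecies G) 4) (Δ : ℝ), 0 < Δ ∧ (∀ n : ℕ, n ≠ 0 → ∀ (σ : Fin n → YMSpecies G) (f : Fin n → SchwartzMap (EuclideanSpace ℝ (Fin 4)) ℝ) (F : SchwartzMap (Fin n → EuclideanSpace ℝ (Fin 4)) ℂ), IsTensorOf F (fun i => ofRealTest (f i)) → IsOffDiagonal F → Filter.Tendsto (fun j : ℕ => ((perturbedLatticeSchwinger ρ (⟨a, ha, ha₀, β', L, haL, c, m⟩ : SpeciesScheme (YMSpecies G)) (fun k => W k (L k)) (fun s => s.F) (φ j) n σ f : ℝ) : ℂ)) Filter.atTop (nhds (T.schwinger n σ F))) ∧ T.IsNontrivial r₃.curvature ∧ T.IsNonGaussian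 r₃.curvature ∧ T.HasMassGap Δ ∧ (∀ A B : YMSpecies G, ∃ C : ℝ, ∀ᶠ k in Filter.atTop, ∀ S : ℕ, L k ≤ S → ∀ n : ℕ, n ≤ S → |(W k S).connectedCorr ρ (β' k) A.F B.F n| ≤ C * Real.exp (-(Δ * (a k * n)))) ∧ (∀ (n : ℕ) (σ : Fin n → YMSpecies G) (f : Fin n → SchwartzMap (EuclideanSpace ℝ (Fin 4)) ℝ), ∃ C : ℝ, ∀ᶠ k in Filter.atTop, ∀ W', AdmAt W' k → ∀ δ : ℝ, 0 ≤ δ → (∀ S : ℕ, L k ≤ S → (W k S - W' k S).NormLE κ δ) → |perturbedLatticeSchwinger ρ (⟨a, ha, ha₀, β', L, haL, c, m⟩ : SpeciesScheme (YMSpecies G)) (fun k => W k (L k)) (fun s => s.F) k n σ f - perturbedLatticeSchwinger ρ (⟨a, ha, ha₀, β', L, haL, c, m⟩ : SpeciesScheme (YMSpecies G)) (fun k => W' k (L k)) (fun s => s.F) k n σ f| ≤ C * δ)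

/-- item stmt-QuantumFields-9496 · crux · rank 4 · closed · moot by None · by planner
why it might fail: Even given E and P it carries robust continuum SU(3) Yang–Mills (OS axioms + full-spectrum gap stable under quasi-local perturbations: open) and U-analytic adaptive filters across level crossings; and if CollarModeTail is refuted as typed the implication becomes vacuous and the route breaks at P.
sources: Balaban1987RG1, Balaban1989LargeFieldII, Balaban1988Convergent, BalabanOcarrollSchor1989, Dimock2022QED3, Dimock2017
[crux] BRIDGE (card K2 ∧ K3 ∧ K4, typed as the implication the Assembly consumes):
AdaptiveCoarseSystem → CollarModeTail → QCD. Content, informally: (K2, composability) realise the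
coarse system by SMOOTH spectral filters of the collar operators (Helffer–Sjöstrand / buffered Riesz
projections, no sharp projectors) so that U ↦ (gens, coarse action) is gauge covariant, measurable,
block-local and real-analytic on Bałaban small-field domains; take the soft RGT weight exp(−(Ψ̄ −
ψ̄Q†)A(U)(Ψ − Qψ)) with the ADAPTIVE coarse weight A(U) = −D_WW + (a/b)·1, for which the fluctuation
covariance (D + Q†AQ)⁻¹ reduces by Schur complement to the compressed inverse of crux 2 (a fixed
shift a/b is singular whenever W holds a real eigenvector of D at −a/b, i.e. on exceptional
configurations — the reason BOS's exponential weight cannot be transplanted verbatim); the coarse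
action a/b − (a/b)²QΓQ† is again γ₅-hermitian (CoarseActionGammaFive), exponentially local
(CompressedPropagatorLocality) and must re-enter the class of crux 2 ("Dirac-like" = γ₅-hermitian,
finite range up to e^{−μ} tails, Re-part = mass + positive Laplacian-like form). (K3, tuned
interleaved flow) alternate this step with Bałaban -/
@[route_item "route-QuantumFields-AdaptiveBlockFermions"]
def ThresholdFlowClosure : Prop :=
  AdaptiveCoarseSystem → CollarModeTail → _root_.QCD

/-- item stmt-QuantumFields-13987 · crux · rank 5 · closed · moot by None · by planner
why it might fail: Carries the whole multiscale analysis: soft steps must compose into a NormLE-admissible W_k = −N_f log det D_W at ℓ₀ with m_crit, Z_m tuned; frames depend non-analytically on U at level crossings; P′ is quenched (N_f=0 ruler) while the flow lives under e^{−βS}det^{N_f}; η₀ of R may be too small.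
sources: BalabanOcarrollSchor1989, BalabanOcarrollSchor1991, Balaban1987RG1, Balaban1989LargeFieldII, Dimock2022QED3, GawedzkiKupiainenMasslessLattice1985
[crux] BRIDGE of the next line: LocalCaptureFrames → QuenchedCollarModeTail → RobustYangMills → QCD.
Content, informally: (K2′) the SOFT adaptive step — Grassmann weight exp(−(Ψ̄ − ψ̄G)(a/b)(Ψ − Gᴴψ))
with the SAME configuration-adapted frame G for ψ and ψ̄ (Bałaban–O'Carroll–Schor's
exponential-weight RGT with Q = Gᴴ), fluctuation operator T = D + (a/b)GGᴴ (soft gap by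
SoftGapFromCapture + WilsonAccretivity, locality by SoftPropagatorLocality), coarse action D′ =
(a/b) − (a/b)²GᴴT⁻¹G (accretive up to O(1/b²) as the Schur complement of an accretive operator,
exponentially local; (D′)⁻¹ = (b/a)·1 + GᴴD⁻¹G, so low modes = blocked low modes and coarse doublers
sit at the cutoff mass a/b); G realised by SMOOTH spectral filters χ((D|collar)ᴴ(D|collar)) with a
U-measurable subsampling, so that the step is gauge covariant and piecewise real-analytic on Bałaban
small-field domains; (K3′) iterate, interleaved with Bałaban's gauge block step, from a_k down to
the threshold block scale ℓ₀ = c/M₀, tuning m_crit(k), Z_m(k) scale-wise (implicit function on the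
relevant mass direction; HasMassScaling), collars with large n_B being large-field events by
QuenchedCollarModeTail (transferred to the d -/
@[route_item "route-QuantumFields-AdaptiveBlockFermions"]
def SoftThresholdClosure : Prop :=
  LocalCaptureFrames → QuenchedCollarModeTail → RobustYangMills → ∀ Nf : ℕ, Nf = 2 ∨ Nf = 3 → ∃ M₀ : ℝ, 0 ≤ M₀ ∧ ∃ reg : Literature.MathematicalPhysics.QuantumFieldTheory.QCDRegularisation Nf, reg.HasMassScaling ∧ ∀ m : Fin Nf → ℝ, (∀ f, M₀ < m f) → ∃ (z shift : Literature.MathematicalPhysics.QuantumFieldTheory.QCDField Nf → ℕ → ℝ) (T : Literature.MathematicalPhysics.QuantumFieldTheory.OSData (Literature.MathematicalPhysics.QuantumFieldTheory.QCDField Nf) 4), Literature.MathematicalPhysics.QuantumFieldTheory.IsQCDAlong (reg.scheme m z shift) T ∧ T.IsNontrivial Literature.MathematicalPhysics.QuantumFieldTheory.QCDField.glue ∧ T.IsNonGaussian Literature.MathematicalPhysics.QuantumFieldTheory.QCDField.glue ∧ (∀ f g : Fin Nf, f ≠ g → T.IsNontrivial (Literature.MathematicalPhysics.QuantumFieldTheory.QCDField.pseudoRe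 f g)) ∧ ∃ Δ > 0, T.HasMassGap Δ ∧ (reg.scheme m z shift).HasLatticeMassGap Δ

/-- item stmt-QuantumFields-13973 · support · rank 9 · closed · moot by None · by planner
sources: MontvayMunster1994, tree:Literature.MathematicalPhysics.QuantumLattice.wilsonDirac
[support] Re⟨x, D_W(U,m,1) x⟩ ≥ m‖x‖² for every SU(3) field, every m and every x: the Hermitian part
of the Wilson–Dirac operator is m + ½Σ_μ(1 − U_μT_μ)ᴴ(1 − U_μT_μ) ≥ m (γ_μ-terms anti-Hermitian;
unitarity of the links; MontvayMunster1994 (4.85)). Provable now from the tree's `wilsonDirac`.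
Feeds the soft-gap lemma SoftGapFromCapture of the route's next line (soft capture-frame block
spin). [difficulty: M] [sources: MontvayMunster1994] -/
@[route_item "route-QuantumFields-AdaptiveBlockFermions"]
def WilsonAccretivity : Prop :=
  ∀ (L : ℕ) [NeZero L] (U : Literature.MathematicalPhysics.QuantumFieldTheory.GaugeConfig 4 L (Matrix.specialUnitaryGroup (Fin 3) ℂ)) (m : ℝ) (x : (Literature.Probability.LatticeModels.TorusSite 4 L × Fin 3 × Fin 4) → ℂ), m * (star x ⬝ᵥ x).re ≤ (star x ⬝ᵥ (Literature.MathematicalPhysics.QuantumLattice.wilsonDirac (Literature.MathematicalPhysics.QuantumLattice.fundamentalRep (Fin 3)) U m 1 *ᵥ x)).re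

/-- item stmt-QuantumFields-13984 · support · rank 9 · closed · moot by None · by planner
sources: BalabanOcarrollSchor1989, BootlandEtAl2022
[support] SOFT GAP IS CHEAP (planner, 2026-08-15 route choice; provable now, five lines). For any
finite matrix D accretive up to −μ (Re⟨x,Dx⟩ ≥ −μ‖x‖²), any Hermitian S with ⟨x,Sx⟩ ≥ 0 and ‖Sx‖² ≤
Θ⟨x,Sx⟩, and the capture inequality ‖x‖² ≤ A‖Dx‖² + K⟨x,Sx⟩: if A(γ + √(τΘ(γ+μ)))² + K(γ+μ)/τ < 1
then ‖(D + τS)x‖ ≥ γ‖x‖ for all x. Proof: for a unit x with ‖Tx‖ < γ, Re⟨x,Tx⟩ < γ forces ⟨x,Sx⟩ <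
(γ+μ)/τ, hence ‖Dx‖ ≤ ‖Tx‖ + τ‖Sx‖ < γ + √(τΘ(γ+μ)), contradicting capture. With A = C_w²b², τ =
a/b, μ = c_res/b² (WilsonAccretivity, window m ≥ −c_res/b²), Θ, K from LocalCaptureFrames and a = 1
this is the b-uniform soft gap γ = c₁/b of BOS's fluctuation operator for EVERY gauge field — the
statement that replaces the refuted hard inf–sup. NOT true for the γ₅-Hermitised operator H + τS
(forced zero crossing on the negative branch): keep D_W itself. [difficulty: S] -/
@[route_item "route-QuantumFields-AdaptiveBlockFermions"]
def SoftGapFromCapture : Prop :=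
  ∀ (n : Type) [Fintype n] [DecidableEq n] (D S : Matrix n n ℂ) (μ τ A K Θ γ : ℝ), 0 ≤ μ → 0 < τ → 0 ≤ A → 0 ≤ K → 0 ≤ Θ → 0 ≤ γ → Sᴴ = S → (∀ x : n → ℂ, 0 ≤ (star x ⬝ᵥ (S *ᵥ x)).re) → (∀ x : n → ℂ, (star (S *ᵥ x) ⬝ᵥ (S *ᵥ x)).re ≤ Θ * (star x ⬝ᵥ (S *ᵥ x)).re) → (∀ x : n → ℂ, -(μ * (star x ⬝ᵥ x).re) ≤ (star x ⬝ᵥ (D *ᵥ x)).re) → (∀ x : n → ℂ, (star x ⬝ᵥ x).re ≤ A * (star (D *ᵥ x) ⬝ᵥ (D *ᵥ x)).re + K * (star x ⬝ᵥ (S *ᵥ x)).re) → A * (γ + Real.sqrt (τ * Θ * (γ + μ))) ^ 2 + K * (γ + μ) / τ < 1 → ∀ x : n → ℂ, γ ^ 2 * (star x ⬝ᵥ x).re ≤ (star ((D + (τ : ℂ) • S) *ᵥ x) ⬝ᵥ ((D + (τ : ℂ) • S) *ᵥ x)).re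

/-- item stmt-QuantumFields-13985 · support · rank 9 · closed · moot by None · by planner
sources: CombesThomas1973, AizenmanGraf1998, BalabanOcarrollSchor1989
[support] COMBES–THOMAS FOR THE SOFT OPERATOR (replaces the dropped hard
CompressedPropagatorLocality). For c₁, a, Θ > 0 there are μ > 0, K such that for every torus, block
side b ≥ 2 with b ∣ L, U, m and every tagged generator family (tags in range, collar-supported,
Bessel ≤ Θ): if T := D + (a/b)Σ_e |g_e⟩⟨g_e| (matrix D + (a/b)Σ vecMulVec g (star g)) has the soft
gap c₁²‖x‖² ≤ b²‖Tx‖², f is supported within torus-ℓ¹-distance b of x₀ and T u = f, then Σ_{p :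
dist(p,x₀) ≥ r·b} |u_p|² ≤ K b² e^{−μ r}‖f‖². Proof sketch: conjugate by e^{νφ/b}, φ = ℓ¹ distance;
hops move by O(ν/b); for the frame term write e^{φ}g = e^{φ(p_B)}·(e^{φ−φ(p_B)}g) with ONE reference
point per home block, so the phases cancel in |g⟩⟨g| and the residual is O(ν)·Θ·(collar-overlap
colouring, ≤ 5⁴ classes); Neumann against the gap c₁/b gives a b-independent rate in block units.
[difficulty: L] -/
@[route_item "route-QuantumFields-AdaptiveBlockFermions"]
def SoftPropagatorLocality : Prop :=
  ∀ c₁ a Θ : ℝ, 0 < c₁ → 0 < a → 0 < Θ → ∃ μ : ℝ, 0 < μ ∧ ∃ K : ℝ, ∀ (L b : ℕ) [NeZero L], 2 ≤ b → b ∣ L → ∀ (U : Literature.MathematicalPhysics.QuantumFieldTheory.GaugeConfig 4 L (Matrix.specialUnitaryGroup (Fin 3) ℂ)) (m : ℝ), let D := Literature.MathematicalPhysics.QuantumLattice.wilsonDirac (Literature.MathematicalPhysics.QuantumLattice.fundamentalRep (Fin 3)) U m 1; let blk : (Literature.Probability.LatticeModels.TorusSite 4 L × Fin 3 × Fin 4)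 → Fin 4 → ℕ := fun p i => (p.1 i).val / b; ∀ gens : Finset ((Fin 4 → ℕ) × ((Literature.Probability.LatticeModels.TorusSite 4 L × Fin 3 × Fin 4) → ℂ)), (∀ e ∈ gens, (∀ i, e.1 i < L / b) ∧ ∀ p, e.2 p ≠ 0 → Literature.MathematicalPhysics.QuantumLattice.blockCollar blk (L / b) e.1 p) → (∀ α : ((Fin 4 → ℕ) × ((Literature.Probability.LatticeModels.TorusSite 4 L × Fin 3 × Fin 4) → ℂ)) → ℂ, (star (∑ e ∈ gens, α e • e.2) ⬝ᵥ (∑ e ∈ gens, α e • e.2)).re ≤ Θ * ∑ e ∈ gens, ‖α e‖ ^ 2) → let T : Matrix (Literature.Probability.LatticeModels.TorusSite 4 L × Fin 3 × Fin 4) (Literature.Probability.LatticeModels.TorusSite 4 L × Fin 3 × Fin 4) ℂ := D + ((a / b : ℝ) : ℂ) • ∑ e ∈ gens, Matrix.vecMulVec e.2 (star e.2); (∀ x : (Literature.Probability.LatticeModels.TorusSite 4 L × Fin 3 × Fin 4) → ℂ, c₁ ^ 2 * (star x ⬝ᵥ x).re ≤ (b : ℝ) ^ 2 * (star (T *ᵥ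 x) ⬝ᵥ (T *ᵥ x)).re) → ∀ (f u : (Literature.Probability.LatticeModels.TorusSite 4 L × Fin 3 × Fin 4) → ℂ) (x₀ : Literature.Probability.LatticeModels.TorusSite 4 L), (∀ p, f p ≠ 0 → (∑ i, min (p.1 i - x₀ i).val (x₀ i - p.1 i).val) ≤ b) → T *ᵥ u = f → ∀ r : ℕ, (∑ p ∈ Finset.univ.filter (fun p : Literature.Probability.LatticeModels.TorusSite 4 L × Fin 3 × Fin 4 => r * b ≤ ∑ i, min (p.1 i - x₀ i).val (x₀ i - p.1 i).val), ‖u p‖ ^ 2) ≤ K * (b : ℝ) ^ 2 * Real.exp (-(μ * r)) * (star f ⬝ᵥ f).re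

/-- item stmt-QuantumFields-13986 · support · rank 9 · closed · moot by None · by planner
sources: Summit.QuantumFields.QCD.Theorems.AdaptiveBlockFermionsAdaptiveCoarseSystem_refuted
[support] NEGATIVE EDGE KEPT COMPILED: ¬(AdaptiveCoarseSystem as first typed) — the statement
refuted by Summit.QuantumFields.QCD.Theorems.AdaptiveBlockFermionsAdaptiveCoarseSystem_refuted
(stmt-QuantumFields-9494; L = 1 witness: (diag(−1,−1,1))³ × rotation by arccos(1−ε) in the (0,2)
colour plane, m = 0; uses only chirality (b) + D-smoothness (e) + coercivity (f)). Filed because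
clearing BROKEN requires dropping the refuted item, and the gate renders dropped items as comments
only, so `def AdaptiveCoarseSystem` will leave this file and the landed Refutation theorem (which
names that decl) stops elaborating (MirrorModularBoosts/MultibosonBridge precedent). This decl is
`Iff.rfl`-equal to `¬ AdaptiveCoarseSystem` (checked in the planner's Sketch.lean before the drop),
so the landed proof closes it verbatim once retargeted; evidence = that proof. Not in the deciding
chain. [difficulty: provable-now] -/
@[route_item "route-QuantumFields-AdaptiveBlockFermions"]
def NotAdaptiveCoarseSystem : Prop :=
  ¬ (∃ c₀ cres c₁ Cs Cw θ Θ : ℝ, 0 < c₀ ∧ 0 < cres ∧ 0 < c₁ ∧ 0 < Cs ∧ 0 < Cw ∧ 0 < θ ∧ 0 < Θ ∧ ∃ N₀ N₁ : ℕ, ∀ (L b : ℕ) [NeZero L], 2 ≤ b → ∀ (U : Literature.MathematicalPhysics.QuantumFieldTheory.GaugeConfig 4 L (Matrix.specialUnitaryGroup (Fin 3) ℂ)) (m : ℝ), -(cres / (b : ℝ) ^ 2) ≤ m → m ≤ 1 → let D := Literature.MathematicalPhysics.QuantumLattice.wilsonDirac (Literature.MathematicalPhysics.QuantumLattice.fundamentalRep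 (Fin 3)) U m 1; let blk : (Literature.Probability.LatticeModels.TorusSite 4 L × Fin 3 × Fin 4) → Fin 4 → ℕ := fun p i => (p.1 i).val / b; let collar : (Fin 4 → ℕ) → (Literature.Probability.LatticeModels.TorusSite 4 L × Fin 3 × Fin 4) → Prop := fun B p => ∀ i, ((blk p i : ℕ) : ZMod (L / b)) - ((B i : ℕ) : ZMod (L / b)) = 0 ∨ ((blk p i : ℕ) : ZMod (L / b)) - ((B i : ℕ) : ZMod (L / b)) = 1 ∨ ((blk p i : ℕ) : ZMod (L / b)) - ((B i : ℕ) : ZMod (L / b)) = -1; let n : (Fin 4 → ℕ) → ℕ := fun B => Fintype.card {i // (Matrix.isHermitian_conjTranspose_mul_self (D.toBlock (collar B) (collar B))).eigenvalues i < (c₀ / b) ^ 2}; ∃ gens : Finset ((Literature.Probability.LatticeModels.TorusSite 4 L × Fin 3 × Fin 4) → ℂ), (∀ g ∈ gens, ∃ B : Fin 4 → ℕ, ∀ p, g p ≠ 0 → collar B p) ∧ (∀ g ∈ gens, (∀ p, g p ≠ 0 → (p.2.2 : ℕ) < 2) ∨ (∀ p, g p ≠ 0 → 2 ≤ (p.2.2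 : ℕ))) ∧ (∀ B : Fin 4 → ℕ, (gens.filter (fun g => ∀ p, g p ≠ 0 → collar B p)).card ≤ N₀ + N₁ * n B) ∧ (∀ α : ((Literature.Probability.LatticeModels.TorusSite 4 L × Fin 3 × Fin 4) → ℂ) → ℂ, θ * (∑ g ∈ gens, ‖α g‖ ^ 2) ≤ (star (∑ g ∈ gens, α g • g) ⬝ᵥ (∑ g ∈ gens, α g • g)).re ∧ (star (∑ g ∈ gens, α g • g) ⬝ᵥ (∑ g ∈ gens, α g • g)).re ≤ Θ * ∑ g ∈ gens, ‖α g‖ ^ 2) ∧ (∀ w ∈ Submodule.span ℂ (↑gens : Set ((Literature.Probability.LatticeModels.TorusSite 4 L × Fin 3 × Fin 4) → ℂ)), (b : ℝ) ^ 2 * (star (D *ᵥ w) ⬝ᵥ (D *ᵥ w)).re ≤ Cs ^ 2 * (star w ⬝ᵥ w).re) ∧ (∀ f, (∀ g ∈ gens, star g ⬝ᵥ f = 0) → (star f ⬝ᵥ f).re ≤ Cw ^ 2 * (b : ℝ) ^ 2 * (star (D *ᵥ f) ⬝ᵥ (D *ᵥ f)).re) ∧ (∀ u, (∀ g ∈ gens,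 star g ⬝ᵥ u = 0) → ∃ v, (∀ g ∈ gens, star g ⬝ᵥ v = 0) ∧ (star v ⬝ᵥ v).re ≤ 1 ∧ c₁ * Real.sqrt ((star u ⬝ᵥ u).re) ≤ (b : ℝ) * (star v ⬝ᵥ (D *ᵥ u)).re))

/-- item stmt-QuantumFields-9497 · support · rank 9 · closed · moot by None · by planner
sources: CombesThomas1973, AizenmanGraf1998, BalabanOcarrollSchor1989
[support] COMBES–THOMAS ENGINE (card P1; provable now). For c₁, C_s > 0 there are μ > 0, K such that
for every torus, block side b ≥ 1, U, m and every finite family of BLOCK-supported generators whose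
span W is D- and D†-smooth (b²‖Dw‖² ≤ C_s²‖w‖², same for Dᴴ) and whose complement F has inf–sup ≥
c₁/b: if f is supported within torus-ℓ¹-distance b of a site x₀ and u ∈ F solves the compressed
equation (⟨v, Du − f⟩ = 0 for all v ∈ F), then Σ_{p : dist(p,x₀) ≥ r·b} |u_p|² ≤ K b² e^{−μ r} ‖f‖²
— exponential locality in BLOCK units with a b-independent rate. Proof sketch (elementary):
conjugate Ã := Q_F D Q_F + (c₁/b)P_W by e^{μ₀φ/b}, φ = ℓ¹ distance; hops contribute O(μ₀/b); the
projector terms contribute O(μ₀(C_s+1)/b) because D-smoothness bounds ‖Q_F D† P_W‖ ≤ C_s/b and [D,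
φ] = O(1); Neumann series against the gap c₁/b. [difficulty: L] -/
@[route_item "route-QuantumFields-AdaptiveBlockFermions"]
def CompressedPropagatorLocality : Prop :=
  ∀ c₁ Cs : ℝ, 0 < c₁ → 0 < Cs → ∃ μ : ℝ, 0 < μ ∧ ∃ K : ℝ, ∀ (L b : ℕ) [NeZero L], 1 ≤ b → ∀ (U : Literature.MathematicalPhysics.QuantumFieldTheory.GaugeConfig 4 L (Matrix.specialUnitaryGroup (Fin 3) ℂ)) (m : ℝ), let D := Literature.MathematicalPhysics.QuantumLattice.wilsonDirac (Literature.MathematicalPhysics.QuantumLattice.fundamentalRep (Fin 3)) U m 1; ∀ gens : Finset ((Literature.Probability.LatticeModels.TorusSite 4 L × Fin 3 × Fin 4) → ℂ), (∀ g ∈ gens, ∃ B : Fin 4 → ℕ, ∀ p, g p ≠ 0 → (fun i => (p.1 i).val / b) = B) → (∀ w ∈ Submodule.span ℂ (↑gens : Set ((Literature.Probability.LatticeModels.TorusSite 4 L × Fin 3 × Fin 4) → ℂ)), (b : ℝ) ^ 2 * (star (D *ᵥ w) ⬝ᵥ (D *ᵥ w)).re ≤ Cs ^ 2 * (star w ⬝ᵥ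 w).re ∧ (b : ℝ) ^ 2 * (star (Dᴴ *ᵥ w) ⬝ᵥ (Dᴴ *ᵥ w)).re ≤ Cs ^ 2 * (star w ⬝ᵥ w).re) → (∀ u, (∀ g ∈ gens, star g ⬝ᵥ u = 0) → ∃ v, (∀ g ∈ gens, star g ⬝ᵥ v = 0) ∧ (star v ⬝ᵥ v).re ≤ 1 ∧ c₁ * Real.sqrt ((star u ⬝ᵥ u).re) ≤ (b : ℝ) * (star v ⬝ᵥ (D *ᵥ u)).re) → ∀ (f u : (Literature.Probability.LatticeModels.TorusSite 4 L × Fin 3 × Fin 4) → ℂ) (x₀ : Literature.Probability.LatticeModels.TorusSite 4 L), (∀ p, f p ≠ 0 → (∑ i, min (p.1 i - x₀ i).val (x₀ i - p.1 i).val) ≤ b) → (∀ g ∈ gens, star g ⬝ᵥ u = 0) → (∀ v, (∀ g ∈ gens, star g ⬝ᵥ v = 0) → star v ⬝ᵥ (D *ᵥ u - f) = 0) → ∀ r : ℕ, (∑ p ∈ Finset.univ.filter (fun p : Literature.Probability.LatticeModels.TorusSite 4 L × Fin 3 × Fin 4 => r * b ≤ ∑ i, min (p.1 i - x₀ i).val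 (x₀ i - p.1 i).val), ‖u p‖ ^ 2) ≤ K * (b : ℝ) ^ 2 * Real.exp (-(μ * r)) * (star f ⬝ᵥ f).re

/-- item stmt-QuantumFields-9498 · support · rank 9 · closed · moot by None · by planner
sources: FrommerEtAl2013, BalabanOcarrollSchor1989, MontvayMunster1994
[support] γ₅-HERMITICITY IS INHERITED (card P1; provable now from the tree's
`wilsonDirac_gammaFive_hermitian_holds`). For any coarse index type κ, any Q : Matrix κ idx ℂ with
orthonormal rows (Q Qᴴ = 1) whose row space is chirality-compatible (Q Γ = E Q, Γ = spinorLift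
gammaFive), any real a and any inverse Tinv of the soft fluctuation operator D + a QᴴQ: E is a
hermitian involution and the soft coarse two-point operator Q Tinv Qᴴ is E-hermitian, E (Q Tinv Qᴴ)
E = (Q Tinv Qᴴ)ᴴ — so BOS's coarse action a − a² Q Tinv Qᴴ is again "γ₅-hermitian" with coarse γ₅ =
E (the closure property the bridge iterates; DD-αAMG's γ₅-preservation). [difficulty: S] -/
@[route_item "route-QuantumFields-AdaptiveBlockFermions"]
def CoarseActionGammaFive : Prop :=
  ∀ (L : ℕ) [NeZero L] (U : Literature.MathematicalPhysics.QuantumFieldTheory.GaugeConfig 4 L (Matrix.specialUnitaryGroup (Fin 3) ℂ)) (m a : ℝ) (κ : Type) [Fintype κ] [DecidableEq κ] (Q : Matrix κ (Literature.Probability.LatticeModels.TorusSite 4 L × Fin 3 × Fin 4) ℂ) (E : Matrix κ κ ℂ) (Tinv : Matrix (Literature.Probability.LatticeModels.TorusSite 4 L × Fin 3 × Fin 4) (Literature.Probability.LatticeModels.TorusSite 4 L × Fin 3 × Fin 4) ℂ), let D := Literature.MathematicalPhysics.QuantumLattice.wilsonDirac (Literature.MathematicalPhysics.QuantumLattice.fundamentalRep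 (Fin 3)) U m 1; let Γ := Literature.MathematicalPhysics.QuantumLattice.spinorLift (L := L) (N := 3) Literature.MathematicalPhysics.QuantumLattice.gammaFive; Q * Qᴴ = 1 → Q * Γ = E * Q → Tinv * (D + (a : ℂ) • (Qᴴ * Q)) = 1 → E * (Q * Tinv * Qᴴ) * E = (Q * Tinv * Qᴴ)ᴴ ∧ Eᴴ = E ∧ E * E = 1

/-- item stmt-QuantumFields-9499 · support · rank 9 · closed · moot by None · by planner
sources: BalabanOcarrollSchor1989, BalabanOcarrollSchor1989LMP, MontvayMunster1994
[support] BOS BASELINE (card P2, first half; provable now). For the free field U ≡ 1 and m ∈ [0, 1],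
plain block constants ⊗ colour ⊗ spin (12 indicator vectors per block) already have the weak
approximation property: dist(v, W) ≤ C_w b ‖D_W(1, m) v‖ with C_w universal (discrete Poincaré on
blocks plus the momentum-space inequality Σ 4 sin²(p_μ/2) ≤ Σ sin² p_μ + (Σ 2 sin²(p_μ/2))², i.e.
‖∇v‖ ≤ ‖Dv‖ for r = 1, m ≥ 0). Records the regime where adaptivity is NOT needed; its failure for
rough U with a real mode of D_W(U) at −m ∈ [−1, 1] (a kernel vector not blockwise constant makes the
right side vanish) is the cheapest illustration of why the coarse space must adapt (kit experiment,
see Cheapest falsifier). [difficulty: M] -/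
@[route_item "route-QuantumFields-AdaptiveBlockFermions"]
def FreeAveragingCoherence : Prop :=
  ∃ Cw : ℝ, 0 < Cw ∧ ∀ (L b : ℕ) [NeZero L], 1 ≤ b → ∀ m ∈ Set.Icc (0 : ℝ) 1, let D := Literature.MathematicalPhysics.QuantumLattice.wilsonDirac (Literature.MathematicalPhysics.QuantumLattice.fundamentalRep (Fin 3)) (fun _ : Literature.MathematicalPhysics.QuantumFieldTheory.Edge 4 L => (1 : Matrix.specialUnitaryGroup (Fin 3) ℂ)) m 1; let W : Submodule ℂ ((Literature.Probability.LatticeModels.TorusSite 4 L × Fin 3 × Fin 4) → ℂ) := Submodule.span ℂ (Set.range fun Bc : (Fin 4 → ℕ) × (Fin 3 × Fin 4) => fun p : Literature.Probability.LatticeModels.TorusSite 4 L × Fin 3 × Fin 4 => if (fun i => (p.1 i).val / b) = Bc.1 ∧ p.2 = Bc.2 then (1 : ℂ) else 0); ∀ v, ∃ w ∈ W, (star (v - w) ⬝ᵥ (v - w)).re ≤ Cw ^ 2 * (b : ℝ) ^ 2 * (star (D *ᵥ v) ⬝ᵥ (D *ᵥ v)).re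

/-- item stmt-QuantumFields-15123 · assembly · rank 9 · closed · moot by None · by planner
[support] audit-g7 threshold re-basing, the shared ThresholdShift statement stmt-QuantumFields-8699
(PROVED by Summit.QuantumFields.QCD.Theorems.thresholdShift_proof; support on RenormalisedVafaWitten
/ HeavyThresholdYMBridge / IntegerCriticalLine / NestedDissectionSea): for every `reg` and M₀ there
is `reg'` (same a, β, L, Z_m; m_crit'(k) = m_crit(k) + a_k M₀/Z_m(k)) with `reg.HasMassScaling →
reg'.HasMassScaling` and `reg'.scheme m z shift = reg.scheme (m + M₀) z shift`. Fifth hypothesis hS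
of this route's deciding theorem `closes`. Re-asked by the route-repair planner (g3) with kind
SUPPORT: this route's entry on the item was badged kind `assembly` at open by mistake, which
deadlocks every BROKEN-repair edit on D-0019 route.multi-assembly. [difficulty: provable-now,
proved] -/
@[route_item "route-QuantumFields-AdaptiveBlockFermions"]
def Assembly : Prop :=
  ∀ (Nf : ℕ) (reg : Literature.MathematicalPhysics.QuantumFieldTheory.QCDRegularisation Nf) (M₀ : ℝ), ∃ reg' : Literature.MathematicalPhysics.QuantumFieldTheory.QCDRegularisation Nf, (reg.HasMassScaling → reg'.HasMassScaling) ∧ ∀ (m : Fin Nf → ℝ) (z shift : Literature.MathematicalPhysics.QuantumFieldTheory.QCDField Nf → ℕ → ℝ), reg'.scheme m z shift = reg.scheme (fun f => m f + M₀) z shift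

-- records of items no longer active in this route (dropped / restated):
-- earlier Assembly2 (stmt-QuantumFields-8699, dropped 2026-08-16T14:43:05Z): proved by Summit.QuantumFields.QCD.Theorems.thresholdShift_proof — ∀ (Nf : ℕ) (reg : Literature.MathematicalPhysics.QuantumFieldTheory.QCDRegularisation Nf) (M₀ : ℝ), ∃ reg' : Literature.MathematicalPhysics.QuantumFieldTheory.QCDRegularisation Nf, (reg.HasMassScaling → reg'.HasMassScaling) ∧ ∀ (m : Fin Nf → ℝ) (z shift : Li
-- earlier Assembly22 (stmt-QuantumFields-9500, dropped 2026-08-16T14:43:05Z): moot by None — LocalCaptureFrames → QuenchedCollarModeTail → RobustYangMills → SoftThresholdClosure → (∀ (Nf : ℕ) (reg : Literature.MathematicalPhysics.QuantumFieldTheory.QCDRegularisation Nf) (M₀ : ℝ), ∃ reg' : Literature.MathematicalPhysics.QuantumFieldTheory.QCDRegularisation Nf, (reg.HasMassScaling → reg'.HasMassScalin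

/-! D-0027 §2.1 — DECIDING THEOREM (planner-authored via `route open/edit --closes-file`; by planner-rfix-QuantumFields-AdaptiveBlockFerm-d5871e0e-g3-0 2026-08-16T08:12:46Z) — ARCHIVED: route closed (refuted) 2026-08-18T22:55:44Z; kept so importers keep building:
its hypotheses are this route's items and its conclusion the sub-problem Statement (glue_lint), and it elaborates with this file. -/

/-- Deciding theorem (D-0027 §2.1) of the route's line (soft capture-frame block spin), THRESHOLD
reading made explicit (audit g7, as in HeavyThresholdYMBridge / NestedDissectionSea): the engine
`LocalCaptureFrames` (E″), the quenched mode-count tail `QuenchedCollarModeTail` (P′), robust SU(3)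
Yang–Mills `RobustYangMills` (R, shared) and the bridge `SoftThresholdClosure`
(B″ : E″ → P′ → R → threshold form of QCDOf 2 ∧ QCDOf 3: all renormalised masses above a witness
offset M₀ ≥ 0) decide `QCD = QCDOf 2 ∧ QCDOf 3`; the audit-g7 threshold re-basing (re-base
m_crit(k) by a_k M₀ / Z_m(k); the shared ThresholdShift statement stmt-QuantumFields-8699, proved in
Theorems/NestedDissectionSeaThresholdShift) is proved INLINE, so the deciding theorem depends on no
assembly-kind entry of the route (route-repair g3, 2026-08-16). -/
@[closes "route-QuantumFields-AdaptiveBlockFermions"] theorem closes (hE : LocalCaptureFrames) (hP : QuenchedCollarModeTail) (hR : RobustYangMills)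
    (hB : SoftThresholdClosure) : _root_.QCD := by
  have h := hB hE hP hR
  have key : ∀ Nf : ℕ, (Nf = 2 ∨ Nf = 3) → QCDOf Nf := by
    intro Nf hNf
    obtain ⟨M₀, hM₀, reg, hms, hbody⟩ := h Nf hNf
    -- audit-g7 threshold re-basing (= Summit.QuantumFields.QCD.Theorems.thresholdShift_generic), inline
    obtain ⟨reg', hms', hsch⟩ : ∃ reg' : Literature.MathematicalPhysics.QuantumFieldTheory.QCDRegularisation Nf,
        (reg.HasMassScaling → reg'.HasMassScaling) ∧
          ∀ (m : Fin Nf → ℝ) (z shift : Literature.MathematicalPhysics.QuantumFieldTheory.QCDField Nf → ℕ → ℝ),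
            reg'.scheme m z shift = reg.scheme (fun f => m f + M₀) z shift := by
      refine ⟨{ reg with mcrit := fun k => reg.mcrit k + reg.a k * M₀ / reg.Zm k }, fun h' => h', ?_⟩
      intro m z shift
      simp only [Literature.MathematicalPhysics.QuantumFieldTheory.QCDRegularisation.scheme,
        Literature.MathematicalPhysics.QuantumFieldTheory.QCDScheme.mk.injEq, and_true, true_and]
      funext f k
      ring
    refine ⟨reg', hms' hms, fun m hm => ?_⟩
    have hm' : ∀ f, M₀ < (fun f => m f + M₀) f := fun f => by
      have := hm f
      simp only
      linarith
    obtain ⟨z, shift, T, hT⟩ := hbody (fun f => m f + M₀) hm'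
    refine ⟨z, shift, T, ?_⟩
    rw [hsch m z shift]
    exact hT
  exact ⟨key 2 (Or.inl rfl), key 3 (Or.inr rfl)⟩

end Summit.QuantumFields.QCD.Theses.AdaptiveBlockFermions
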